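import Mathlib
import HarnessLib
import Summits.Ventures.LatticeQCDFlow.Exactness.LatticeCoordAvg
import Summits.Ventures.LatticeQCDFlow.Exactness.PTBCWilsonDefect

/-!
# Relabelling the sites: `π = ⊗_ι μ` is invariant under `ω ↦ ω ∘ τ` for every permutation `τ` of `ι`, `A_s(G ∘ (· ∘ τ))(ω) = A_{τ⁻¹s} G (ω ∘ τ)`, and the corridor-conditional variance of a translated block term equals that of the original: `Var_π(A_s(G ∘ (· ∘ τ))) = Var_π(A_{τ⁻¹ s} G)`

HONEST FRAMING: exact (Metropolis-corrected) sampling algorithms for lattice gauge theory;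
figures of merit are autocorrelation/cost numbers at stated couplings and volumes; no
continuum-physics claim.

Venture `LatticeQCDFlow` (cell pub-lqcd), topic `Exactness`; FANOUT row 7 (`s0-cpn-null`).  NEW WORK
of the cell over the tree's `Exactness/LatticeCoordAvg.lean` (`coordAvg`, `integrable_pi_of_continuous`,
`continuous_piecewise_prod`), row 22's `Exactness/PTBCWilsonDefect.lean` (REUSED: `measurePreserving_comp_equiv`,
precomposition with a bijection of the index preserves the product of equal laws) and Mathlib
(`integral_map`); nothing is cited as a fact.  Printed counterpart, NAMED ONLY: translation invariance of product measures [folklore].  WHY: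
the volume laws of this lineage (`LatticeIndependenceSamplerVolumeLaw`, `…EntropyFloor`,
`…AcceptanceCeiling`, `…EventTauInt`, `LatticeBlockSecondMomentTensorization`) take as input a floor
`v ≤ Var_π(A_C h_j)` for EVERY block `j`; when the blocks are translates `h_j = h ∘ (· ∘ τ_j)` of one
block term by lattice symmetries `τ_j` preserving the corridor `C`, this file reduces the input to ONE
block: `Var_π(A_C h_j) = Var_π(A_C h)`.

## Content (`τ : ι ≃ ι`; `π = ⊗_ι μ`, `μ` a probability measure on `X`)

* `integral_pi_comp_equiv` — `∫ G(ω ∘ τ) dπ = ∫ G dπ` (continuous `G`; the tree's `measurePreserving_comp_equiv`).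
* `piecewise_comp_equiv` — `(s.piecewise ω' ω) ∘ τ = (τ⁻¹s).piecewise (ω' ∘ τ) (ω ∘ τ)`,
  `τ⁻¹s = s.map τ.symm`.
* **`coordAvg_comp_equiv`** — `A_s(G ∘ (· ∘ τ))(ω) = A_{τ⁻¹ s} G (ω ∘ τ)`.
* **`variance_coordAvg_comp_equiv`** — `∫(A_s(G∘(·∘τ)) − ∫G∘(·∘τ))² dπ = ∫(A_{τ⁻¹s} G − ∫G)² dπ`; in
  particular (`coordAvg_comp_equiv_of_map_eq`) if `τ⁻¹ s = s` the block term `G ∘ (· ∘ τ)` has the same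
  `A_s`-conditional variance as `G`.

NOT CLAIMED: anything model-specific; numbers.
-/

noncomputable section

namespace Summit.Ventures.LatticeQCDFlow.Exactness

open Function Set MeasureTheory
open scoped Topology

variable {ι : Type*} [Fintype ι] [DecidableEq ι]
variable {X : Type*} [MeasurableSpace X] [MetricSpace X] [CompactSpace X] [BorelSpace X]
  (μ : Measure X) [IsProbabilityMeasure μ]

omit [DecidableEq ι] in
/-- `∫ G(ω ∘ τ) dπ = ∫ G dπ` for continuous `G`. -/
theorem integral_pi_comp_equiv (τ : ι ≃ ι) {G : (ι → X) → ℝ} (hG : Continuous G) :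
    ∫ ω, G (ω ∘ τ) ∂Measure.pi (fun _ : ι => μ) = ∫ ω, G ω ∂Measure.pi (fun _ : ι => μ) := by
  have h := measurePreserving_comp_equiv τ μ
  rw [← integral_map h.measurable.aemeasurable (by rw [h.map_eq]; exact hG.aestronglyMeasurable), h.map_eq]

omit [Fintype ι] [MeasurableSpace X] [MetricSpace X] [CompactSpace X] [BorelSpace X] in
/-- Gluing commutes with relabelling: `(s.piecewise ω' ω) ∘ τ = (s.map τ⁻¹).piecewise (ω' ∘ τ) (ω ∘ τ)`. -/
theorem piecewise_comp_equiv (τ : ι ≃ ι) (s : Finset ι) (ω ω' : ι → X) :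
    (s.piecewise ω' ω) ∘ τ = (s.map τ.symm.toEmbedding).piecewise (ω' ∘ τ) (ω ∘ τ) := by
  funext i
  simp only [Function.comp_apply]
  by_cases hi : τ i ∈ s
  · rw [Finset.piecewise_eq_of_mem _ _ _ hi, Finset.piecewise_eq_of_mem _ _ _ (by
      rw [Finset.mem_map_equiv]; simpa using hi)]
    rfl
  · rw [Finset.piecewise_eq_of_notMem _ _ _ hi, Finset.piecewise_eq_of_notMem _ _ _ (by
      rw [Finset.mem_map_equiv]; simpa using hi)]
    rfl

/-- **`A_s(G ∘ (· ∘ τ))(ω) = A_{τ⁻¹ s} G (ω ∘ τ)`** for continuous `G`. -/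
theorem coordAvg_comp_equiv (τ : ι ≃ ι) (s : Finset ι) {G : (ι → X) → ℝ} (hG : Continuous G)
    (ω : ι → X) :
    coordAvg μ s (fun η => G (η ∘ τ)) ω = coordAvg μ (s.map τ.symm.toEmbedding) G (ω ∘ τ) := by
  unfold coordAvg
  simp_rw [piecewise_comp_equiv τ s ω]
  have hc : Continuous fun η : ι → X =>
      G ((s.map τ.symm.toEmbedding).piecewise η (ω ∘ τ)) :=
    hG.comp ((continuous_piecewise_prod _).comp (Continuous.prodMk_right _))
  exact integral_pi_comp_equiv μ τ (G := fun η => G ((s.map τ.symm.toEmbedding).piecewise η (ω ∘ τ))) hc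

/-- **THE CONDITIONAL VARIANCE OF A RELABELLED BLOCK TERM**:
`∫ (A_s(G ∘ (· ∘ τ))(ω) − ∫ G(ω' ∘ τ) dπ)² dπ = ∫ (A_{τ⁻¹ s} G(ω) − ∫ G dπ)² dπ`. -/
theorem variance_coordAvg_comp_equiv (τ : ι ≃ ι) (s : Finset ι) {G : (ι → X) → ℝ} (hG : Continuous G) :
    ∫ ω, (coordAvg μ s (fun η => G (η ∘ τ)) ω -
        ∫ ω', G (ω' ∘ τ) ∂Measure.pi (fun _ : ι => μ)) ^ 2 ∂Measure.pi (fun _ : ι => μ) =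
      ∫ ω, (coordAvg μ (s.map τ.symm.toEmbedding) G ω -
        ∫ ω', G ω' ∂Measure.pi (fun _ : ι => μ)) ^ 2 ∂Measure.pi (fun _ : ι => μ) := by
  simp_rw [coordAvg_comp_equiv μ τ s hG, integral_pi_comp_equiv μ τ hG]
  have hc : Continuous fun ω : ι → X =>
      (coordAvg μ (s.map τ.symm.toEmbedding) G ω - ∫ ω', G ω' ∂Measure.pi (fun _ : ι => μ)) ^ 2 :=
    ((continuous_coordAvg μ _ hG).sub continuous_const).pow 2
  exact integral_pi_comp_equiv μ τ (G := fun ω => (coordAvg μ (s.map τ.symm.toEmbedding) G ω -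
    ∫ ω', G ω' ∂Measure.pi (fun _ : ι => μ)) ^ 2) hc

/-- **Corollary (invariant corridor)**: if `s.map τ⁻¹ = s`, the translated block term `G ∘ (· ∘ τ)` has
the same `A_s`-conditional variance as `G`. -/
theorem variance_coordAvg_comp_equiv_of_map_eq (τ : ι ≃ ι) {s : Finset ι}
    (hs : s.map τ.symm.toEmbedding = s) {G : (ι → X) → ℝ} (hG : Continuous G) :
    ∫ ω, (coordAvg μ s (fun η => G (η ∘ τ)) ω -
        ∫ ω', G (ω' ∘ τ) ∂Measure.pi (fun _ : ι => μ)) ^ 2 ∂Measure.pi (fun _ : ι => μ) =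
      ∫ ω, (coordAvg μ s G ω - ∫ ω', G ω' ∂Measure.pi (fun _ : ι => μ)) ^ 2 ∂Measure.pi (fun _ : ι => μ) := by
  rw [variance_coordAvg_comp_equiv μ τ s hG, hs]

end Summit.Ventures.LatticeQCDFlow.Exactness

end
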